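/-
Copyright (c) 2026 the pub-hodgecm-mathlib formalisation cell (harness21).  Prover seat hodgecm-mathlib-LD1-p01 (g5), ROAD O («orthogonal copy»)
of line LD — the PIN ASSEMBLY part 2 (the PIN), 2026-09-02.  THEOREMS ONLY (no definition, no named fact, no `sorry`, no instance, no notation).
`--supports stmt-HodgeConjecture-24832 --as helper`.
-/
import Summits.HodgeConjecture.HodgeConjecture.Theorems.F0LD1ThetaSpanLinePinOfBricks
import Summits.HodgeConjecture.HodgeConjecture.Theorems.F0LD1ThetaSpanPinDefs
import Summits.HodgeConjecture.HodgeConjecture.Theorems.F0LD1ThetaSpanDoorsOfEquiv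
import Summits.HodgeConjecture.HodgeConjecture.Theorems.F0LD1ArchTypeAwayOfInvariant
import Summits.HodgeConjecture.HodgeConjecture.Theorems.F0LD1ThetaCharRigidOfDichotomy
import Summits.HodgeConjecture.HodgeConjecture.Theorems.F0P6LD1ThetaCharacterPin
import Summits.HodgeConjecture.HodgeConjecture.Theorems.F0P6LD1TransportRational
import Summits.HodgeConjecture.HodgeConjecture.Theorems.F0LD1LineTransportOfKits
import Summits.HodgeConjecture.HodgeConjecture.Theorems.F0LD2LetterR2OfLineComplementary
import Summits.HodgeConjecture.HodgeConjecture.Theorems.F0LD2LineThetaTypesComplementary1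
import Summits.HodgeConjecture.HodgeConjecture.Theorems.F0LD2OperatorWords
import Summits.HodgeConjecture.HodgeConjecture.Theorems.F0LD1ThetaDichotomyOfBricks
import Summits.HodgeConjecture.HodgeConjecture.Theorems.F0LD1ThetaSliceHermiteSum
import Summits.HodgeConjecture.HodgeConjecture.Theorems.F0LD1ThetaSliceTorusProjectorOrgan
import Summits.HodgeConjecture.HodgeConjecture.Theorems.F0LD1ThetaSliceFiniteLevel
import Summits.HodgeConjecture.HodgeConjecture.Theorems.F0LD1ThetaSliceMeasureScaling
import Summits.HodgeConjecture.HodgeConjecture.Theorems.F0LD1ThetaArchLadderHolds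
import Summits.HodgeConjecture.HodgeConjecture.Theorems.F0LD1ThetaFinGeneration
import HarnessLib

-- As in the lineage: statements over the theta-kernel datum elaborate to very large types; elaborate sequentially.
set_option Elab.async false

/-!
# Crux `HLiu418`, line LD, ROAD O — THE UNITARY-CLASS PIN OF THETA SPANS ★ `F0LD1ThetaSpanPinDefs.ThetaSpanPin₂` FROM ITS BRICKS: for a hol₂ `P` with the θ-type finite
# component `σ`, two non-zero closed theta spans `Q̄(a′, ξ′)`, `Q̄(b, ξ″)` both unitarily equivalent to `P` COINCIDE

Cell hodgecm-mathlib (D-0151), FLOOR 0; crux item `HLiu418` = stmt-HodgeConjecture-24832; LD leaves ED. 10 (`stub_letter_B6`).  Seat LD1-p01 (g5); chair LD1-plan (g3)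
HANDS v3–v6; LD-ref1 BOX ROAD-O #1–#5, PIN-WATCH #1 (answered «N»: no class-level span transport — organ (I) does it).  THEOREMS ONLY; `--supports stmt-HodgeConjecture-24832`.
Part 2 of the PIN ASSEMBLY (part 1: ★ `F0LD1ThetaSpanLinePinOfBricks.spanLinePin_of_bricks` — the LINE half).  Consumer: ★ `F0LD1ThetaRealisationOfOrthogonalCopy.thetaRealisation₂_of_orthogonalCopy
(hAP♮) (hIrr) (hPin : ThetaSpanPin₂)` (LD2-p01 (g5)), leaf ED. 11 organ (R).

* `thetaSpanPin₂_of_bricks (hR) (hα) (hLT) (hAwayU) : ThetaSpanPin₂` — from part 1 (`locF a′ = locF b`, `a′ b⁻¹ ≫ 0`): `hLT` (★ `lineTransport₂_of_kits`) moves `Q″`'s seam from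
  `b` to `a′`; ★ organ (I) `thetaCharRigid₂_of_dichotomy hα` on the discrete `⟨Q″, irr⟩` gives `ξ‴` with EVERY `(a′,ξ‴)`-class in `Q″` and a non-zero one; the central character
  `ψ` of `P` rides `≃ᵤ` to `Q′`, `Q″` (★ (T2)), so ★ `charCM_eq_of_seams_of_centralCharacter_eq` gives `ξ′ = ξ‴`; hence `Q′ = closure (span (a′,ξ′)-classes) ≤ Q″`, `Q′ ≠ ⊥`, `Q″`
  irreducible ⇒ `Q′ = Q″` (★ `eq_of_le_of_isTopIrreducible`).
* `thetaSpanPin₂_of_away (hAwayU) : ThetaSpanPin₂` — the three ★ in-house inputs DISCHARGED: R₂ := ★ `lemD1_4SameLabelNonsplitCM₂_of_lineThetaTypesComplementary₁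
  (lineThetaTypesComplementary₁_of_zVan zVan_holds)`, (Gα) := ★ `thetaDichotomy₂_of_localBricks` of the six ★ bricks, `hLT` := ★ `lineTransport₂_of_kits`; the one input left is
  (β-away) in unitary-class currency (`archTypeAway₂_of_invariant` + door `kcInvariant_of_areUnitarilyEquivalent`).

HONEST LABEL: HC_CM is proved only modulo the 7 printed citations (2 remaining: hLiu418 = stmt-HodgeConjecture-24832, h413 = stmt-HodgeConjecture-24833)
until rung 0 closes; (B6) is BYPASSED for hol `P` only; this file discharges nothing printed (in-house pin; its inputs are ★ or in-house bricks).

## References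
* [Liu2021] Y. Liu, Camb. J. Math. 9 (2021) = arXiv:2102.11518: App. B Thm. B.4 (2) (p. 98), proof of Cor. B.6 (3) (p. 99 L41–67); App. D Lem. D.1 (4), D.2 (1)(3),
  proof of Prop. D.4 (1) (p. 131).
* [HarrisKudlaSweet1996] M. Harris, S. Kudla, W. J. Sweet, JAMS 9 (1996), Thm. 6.1.  [SunZhu2014] B. Sun, C.-B. Zhu, JAMS 28, Thm. 1.10.
* [DeitmarEchterhoff2014] A. Deitmar, S. Echterhoff, 2nd ed., Cor. 6.1.9, Lemma 6.1.7.  [BorelJacquet1979] A. Borel, H. Jacquet, PSPM 33.1, §4.6.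
-/


set_option autoImplicit false
-- the mandated namespace has the single-problem summit's repeated segment (`HodgeConjecture.HodgeConjecture`)
set_option linter.dupNamespace false

noncomputable section

open NumberField NumberField.InfinitePlace MeasureTheory IsDedekindDomain
open scoped Matrix ComplexOrder ENNReal InnerProductSpace

namespace Summit.HodgeConjecture.HodgeConjecture.Cruxes.HLiu418.F0LD1ThetaSpanPinOfBricks

open _root_.MeasureTheory
open Literature.NumberTheory.Automorphic Literature.NumberTheory.Automorphic.UnitaryGroup
open Literature.NumberTheory.Automorphic.UnitaryGroup.CotangentForms
open Literature.NumberTheory.Automorphic.UnitaryCurveForms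
open Literature.NumberTheory.Automorphic.IdeleClassGroup
open Literature.NumberTheory.Automorphic.Liu2021
open Literature.NumberTheory.Automorphic.Liu2021.Def411WeilCarriers
open Literature.NumberTheory.Automorphic.Liu2021.Def411WeilCarriersDoubling
open Literature.NumberTheory.Automorphic.Liu2021.LemD1RankTwoCMLetters
open Literature.NumberTheory.GaloisRepresentations
open Literature.NumberTheory.GelbartRogawski1991 Literature.NumberTheory.GelbartRogawski1991.UnitaryDualPair
open Literature.NumberTheory.Weil1964
open Literature.RepresentationTheory.Liu2021 Literature.RepresentationTheory.HarrisKudlaSweet1996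
open Literature.RepresentationTheory.CompactGroups
open Literature.AlgebraicGeometry.ShimuraVarieties
open Literature.NumberTheory.Rogawski1990
open Summit.HodgeConjecture.HodgeConjecture.Cruxes.HLiu418.F0LD1ThetaTransportKit
open Summit.HodgeConjecture.HodgeConjecture.Cruxes.HLiu418.F0LD2FrameTransportPin
open Summit.HodgeConjecture.HodgeConjecture.Cruxes.HLiu418.F0LD1CharThetaSpaceLeOfIrreducible
open Summit.HodgeConjecture.HodgeConjecture.Cruxes.HLiu418.F0LD1ThetaGermDefs (ThetaDichotomy₂)
open Summit.HodgeConjecture.HodgeConjecture.Cruxes.HLiu418.F0LD1ThetaSpanLinePinOfBricks (exists_mem_ne_zero_of_closure_span)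

set_option maxHeartbeats 6400000 in
-- (statement size: four organ-sized hypotheses; every step is a named ★ lemma)
/-- **THE UNITARY-CLASS PIN OF THETA SPANS FROM ITS BRICKS** (module docstring): `ThetaSpanPin₂` from letter R₂, organ (Gα), line transport and the away-from-`ι` signs.
[cite: Liu2021, App. B Thm. B.4 (2) (p. 98); proof of Cor. B.6 (3) (p. 99 L41–67); App. D Lem. D.1 (4), D.2 (1)(3); proof of Prop. D.4 (1) (p. 131)]
[cite: HarrisKudlaSweet1996, Thm. 6.1] [cite: DeitmarEchterhoff2014, Cor. 6.1.9] -/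
theorem thetaSpanPin₂_of_bricks (hR : LemD1_4SameLabelNonsplitCM₂) (hα : ThetaDichotomy₂)
    (hLT : ∀ (L : Type) [Field L] [NumberField L] [IsCMField L] (ι : L →+* ℂ) (H : Matrix (Fin 2) (Fin 2) L)
        (dV : Fin 2 → L) (hdV : ∀ i, IsCMField.complexConj L (dV i) = dV i) (hdV0 : ∀ i, dV i ≠ 0)
        (t : L) (ht : t ≠ 0) (g : GL (Fin 2) L)
        (hg : formCongr ((IsCMField.complexConj L : L ≃ₐ[↥(maximalRealSubfield L)] L) : L →+* L) g (t • H) = Matrix.diagonal dV),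
        (∃ T : GL (Fin 2) ℂ, formCongr (starRingEnd ℂ) T ((Matrix.diagonal dV).map ι) = Matrix.diagonal ![(1 : ℂ), -1]) →
        (∀ τ' : L →+* ℂ, InfinitePlace.mk τ' ≠ InfinitePlace.mk ι → ((Matrix.diagonal dV).map τ').PosDef) →
        4 ≤ Module.finrank ℚ L →
        ∀ (μ : Measure (adelicGroupData (↥(maximalRealSubfield L)) L (IsCMField.complexConj L) 2 H).automorphicQuotient)
          [(adelicGroupData (↥(maximalRealSubfield L)) L (IsCMField.complexConj L) 2 H).IsAutomorphicMeasure μ]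
          {n' : ℕ} (e₁ : Fin 2 × Fin 1 ≃ Fin n')
          (lam : Literature.NumberTheory.Automorphic.IdeleClassGroup L →ₜ* Circle) (hlam : IsConjugateSymplectic L lam), HasWeight L lam 1 →
        ∀ (ιA : (adelicGroupData (↥(maximalRealSubfield L)) L (IsCMField.complexConj L) 2 H).Adelic →*
            ↥(UnitaryGroup.adelic (↥(maximalRealSubfield L)) L (IsCMField.complexConj L) 2 (Matrix.diagonal dV))),
          (∀ k, ((ιA k : ↥(UnitaryGroup.adelic (↥(maximalRealSubfield L)) L (IsCMField.complexConj L) 2 (Matrix.diagonal dV))) :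
                GL (Fin 2) (AdeleRing (𝓞 L) L)) =
              (toAdeleGL L g)⁻¹ * adelicVal (↥(maximalRealSubfield L)) L (IsCMField.complexConj L) 2 H k * toAdeleGL L g) →
        ∀ [CompactSpace (↥(UnitaryGroup.adelic (↥(maximalRealSubfield L)) L (IsCMField.complexConj L) 2 (Matrix.diagonal dV)) ⧸
            (UnitaryGroup.toAdelic (↥(maximalRealSubfield L)) L (IsCMField.complexConj L) 2 (Matrix.diagonal dV)).range)],
        ∀ (P : DiscreteAutomorphicRep (adelicGroupData (↥(maximalRealSubfield L)) L (IsCMField.complexConj L) 2 H) μ) (a'' a₁ : (↥(maximalRealSubfield L))ˣ),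
          MeetsThetaLiftFromLine L 2 H e₁ dV hdV hdV0 P lam hlam a'' ιA →
          (∀ v : HeightOneSpectrum (𝓞 (↥(maximalRealSubfield L))),
            locF (↥(maximalRealSubfield L)) (imagUnitSq L) a₁ v = locF (↥(maximalRealSubfield L)) (imagUnitSq L) a'' v) →
          (∀ ρ : (↥(maximalRealSubfield L)) →+* ℝ, 0 < ρ ((a₁ : (↥(maximalRealSubfield L))) * ((a'' : (↥(maximalRealSubfield L))))⁻¹)) →
          MeetsThetaLiftFromLine L 2 H e₁ dV hdV hdV0 P lam hlam a₁ ιA)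
    (hAwayU : ∀ (L : Type) [Field L] [NumberField L] [IsCMField L] (ι : L →+* ℂ) (H : Matrix (Fin 2) (Fin 2) L)
        (dV : Fin 2 → L) (hdV : ∀ i, IsCMField.complexConj L (dV i) = dV i) (hdV0 : ∀ i, dV i ≠ 0)
        (t : L) (ht : t ≠ 0) (g : GL (Fin 2) L)
        (hg : formCongr ((IsCMField.complexConj L : L ≃ₐ[↥(maximalRealSubfield L)] L) : L →+* L) g (t • H) = Matrix.diagonal dV),
        (∃ T : GL (Fin 2) ℂ, formCongr (starRingEnd ℂ) T ((Matrix.diagonal dV).map ι) = Matrix.diagonal ![(1 : ℂ), -1]) →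
        (∀ τ' : L →+* ℂ, InfinitePlace.mk τ' ≠ InfinitePlace.mk ι → ((Matrix.diagonal dV).map τ').PosDef) →
        4 ≤ Module.finrank ℚ L →
        ∀ (𝔣 : ConeFrame L H (cmPlace L ι))
          (μ : Measure (adelicGroupData (↥(maximalRealSubfield L)) L (IsCMField.complexConj L) 2 H).automorphicQuotient)
          [(adelicGroupData (↥(maximalRealSubfield L)) L (IsCMField.complexConj L) 2 H).IsAutomorphicMeasure μ]
          {n' : ℕ} (e₁ : Fin 2 × Fin 1 ≃ Fin n')
          (lam : Literature.NumberTheory.Automorphic.IdeleClassGroup L →ₜ* Circle) (hlam : IsConjugateSymplectic L lam),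
        ∀ (ιA : (adelicGroupData (↥(maximalRealSubfield L)) L (IsCMField.complexConj L) 2 H).Adelic →*
            ↥(UnitaryGroup.adelic (↥(maximalRealSubfield L)) L (IsCMField.complexConj L) 2 (Matrix.diagonal dV))),
          (∀ k, ((ιA k : ↥(UnitaryGroup.adelic (↥(maximalRealSubfield L)) L (IsCMField.complexConj L) 2 (Matrix.diagonal dV))) :
                GL (Fin 2) (AdeleRing (𝓞 L) L)) =
              (toAdeleGL L g)⁻¹ * adelicVal (↥(maximalRealSubfield L)) L (IsCMField.complexConj L) 2 H k * toAdeleGL L g) →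
        ∀ [CompactSpace (↥(UnitaryGroup.adelic (↥(maximalRealSubfield L)) L (IsCMField.complexConj L) 2 (Matrix.diagonal dV)) ⧸
            (UnitaryGroup.toAdelic (↥(maximalRealSubfield L)) L (IsCMField.complexConj L) 2 (Matrix.diagonal dV)).range)],
        ∀ (P P₁ : DiscreteAutomorphicRep (adelicGroupData (↥(maximalRealSubfield L)) L (IsCMField.complexConj L) 2 H) μ) (a₁ : (↥(maximalRealSubfield L))ˣ),
          P.IsHolCotangentAt₂ (IsCMField.complexConj_ne_one L) (UnitaryGroup.complexConj_smul_infinitePlace L) (cmPlace L ι) 𝔣 →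
          ContRepresentation.AreUnitarilyEquivalent P.space.toContRep P₁.space.toContRep →
          MeetsThetaLiftFromLine L 2 H e₁ dV hdV hdV0 P₁ lam hlam a₁ ιA →
          ∀ τ' : L →+* ℂ, InfinitePlace.mk τ' ≠ InfinitePlace.mk ι →
            (exponentAt hlam.infinityType τ' = -1 ∧ (τ' (algebraMap (↥(maximalRealSubfield L)) L a₁ * (2 * imagUnit L)⁻¹)).im < 0) ∨
              (exponentAt hlam.infinityType τ' = 1 ∧ 0 < (τ' (algebraMap (↥(maximalRealSubfield L)) L a₁ * (2 * imagUnit L)⁻¹)).im)) :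
    Summit.HodgeConjecture.HodgeConjecture.Cruxes.HLiu418.F0LD1ThetaSpanPinDefs.ThetaSpanPin₂ := by
  intro L _ _ _ ι H dV hdV hdV0 t ht g hg hsig hdef h4 𝔣 μ _ n' e₁ lam hlam hw a χ W _ _ σ hirr hsm j hj ιA hιA _ P hP hPσ a' b
  letI : MeasurableSpace (↥(UnitaryGroup.adelic (↥(maximalRealSubfield L)) L (IsCMField.complexConj L) 1 (JW (↥(maximalRealSubfield L)) L a')) ⧸ (UnitaryGroup.toAdelic (↥(maximalRealSubfield L)) L (IsCMField.complexConj L) 1 (JW (↥(maximalRealSubfield L)) L a')).range) := borel _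
  haveI : BorelSpace (↥(UnitaryGroup.adelic (↥(maximalRealSubfield L)) L (IsCMField.complexConj L) 1 (JW (↥(maximalRealSubfield L)) L a')) ⧸ (UnitaryGroup.toAdelic (↥(maximalRealSubfield L)) L (IsCMField.complexConj L) 1 (JW (↥(maximalRealSubfield L)) L a')).range) := ⟨rfl⟩
  haveI := normal_range_toAdelic_JW L a'
  letI : MeasurableSpace (↥(UnitaryGroup.adelic (↥(maximalRealSubfield L)) L (IsCMField.complexConj L) 1 (JW (↥(maximalRealSubfield L)) L b)) ⧸ (UnitaryGroup.toAdelic (↥(maximalRealSubfield L)) L (IsCMField.complexConj L) 1 (JW (↥(maximalRealSubfield L)) L b)).range) := borel _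
  haveI : BorelSpace (↥(UnitaryGroup.adelic (↥(maximalRealSubfield L)) L (IsCMField.complexConj L) 1 (JW (↥(maximalRealSubfield L)) L b)) ⧸ (UnitaryGroup.toAdelic (↥(maximalRealSubfield L)) L (IsCMField.complexConj L) 1 (JW (↥(maximalRealSubfield L)) L b)).range) := ⟨rfl⟩
  haveI := normal_range_toAdelic_JW L b
  intro ξ' ξ'' Q' Q'' hQ' hQ'' hQ'ne hPQ' hPQ''
  -- 0. transport data, compactness, unitarity
  have hιA' : Continuous ιA ∧ ∀ ⦃γ : (adelicGroupData (↥(maximalRealSubfield L)) L (IsCMField.complexConj L) 2 H).Adelic⦄,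
      γ ∈ (UnitaryGroup.toAdelic (↥(maximalRealSubfield L)) L (IsCMField.complexConj L) 2 H).range →
        ιA γ ∈ (UnitaryGroup.toAdelic (↥(maximalRealSubfield L)) L (IsCMField.complexConj L) 2 (Matrix.diagonal dV)).range :=
    ⟨continuous_of_pin L 2 H dV g ιA hιA, fun _ hγ => mem_range_toAdelic_of_pin L 2 H dV t ht g hg ιA hιA hγ⟩
  have hιArat := Summit.HodgeConjecture.HodgeConjecture.Cruxes.HLiu418.F0P6LD1TransportRational.transport_toAdelic_mem_range L 2 H dV g ιA hιA
  haveI : CompactSpace (adelicGroupData (↥(maximalRealSubfield L)) L (IsCMField.complexConj L) 2 H).automorphicQuotient := by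
    obtain ⟨τ, hτ⟩ := UnitaryGroup.exists_infinitePlace_ne L h4 ι
    exact UnitaryGroup.compactSpace_adelicGroupData_automorphicQuotient L 2 H
      (UnitaryGroup.anisotropic_of_formCongr_smul_eq_of_posDef L 2 H dV t ht g hg τ (hdef τ hτ))
  have hR2 := (adelicGroupData (↥(maximalRealSubfield L)) L (IsCMField.complexConj L) 2 H).isUnitary_rightRegular μ
  -- 1. the spans are irreducible (they are `≃ᵤ P`) and non-zero
  obtain ⟨e', he'⟩ := hPQ'
  obtain ⟨e'', he''⟩ := hPQ''
  have hQ'irr : Q'.toContRep.IsTopIrreducible := (ContRepresentation.isTopIrreducible_congr e').1 P.irreducible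
  have hQ''irr : Q''.toContRep.IsTopIrreducible := (ContRepresentation.isTopIrreducible_congr e'').1 P.irreducible
  let P' : DiscreteAutomorphicRep (adelicGroupData (↥(maximalRealSubfield L)) L (IsCMField.complexConj L) 2 H) μ := ⟨Q', hQ'irr⟩
  let P'' : DiscreteAutomorphicRep (adelicGroupData (↥(maximalRealSubfield L)) L (IsCMField.complexConj L) 2 H) μ := ⟨Q'', hQ''irr⟩
  have hPQ' : ContRepresentation.AreUnitarilyEquivalent P.space.toContRep P'.space.toContRep := ⟨e', he'⟩
  have hPQ'' : ContRepresentation.AreUnitarilyEquivalent P.space.toContRep P''.space.toContRep := ⟨e'', he''⟩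
  have hQ''ne : Q''.toSubmodule ≠ ⊥ := by
    intro hbot
    obtain ⟨⟨v, hv⟩, hv0⟩ := @exists_ne _ P.nontrivial_space (0 : P.space.toSubmodule)
    have h1 : (e'' ⟨v, hv⟩ : Q''.toSubmodule) = 0 := by
      apply Subtype.ext
      exact (Submodule.mem_bot ℂ).1 (hbot ▸ (e'' ⟨v, hv⟩).2)
    exact hv0 (EquivLike.injective e'' (by rw [h1, map_zero]))
  -- 2. generators: a non-zero `(a′,ξ′)`-class IN `Q′`, a non-zero `(b,ξ″)`-class IN `Q″`; the spans MEET their own lines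
  obtain ⟨v', hv'S, hv'0⟩ := exists_mem_ne_zero_of_closure_span hQ' hQ'ne
  obtain ⟨hρ', μW', hfin', hinv', Ψ', hθ', rfl⟩ := hv'S
  have hmem' : MemLp.toLp _ hθ' ∈ Q'.toSubmodule := by
    rw [← SetLike.mem_coe, hQ']
    exact subset_closure (Submodule.subset_span ⟨hρ', μW', hfin', hinv', Ψ', hθ', rfl⟩)
  obtain ⟨v'', hv''S, hv''0⟩ := exists_mem_ne_zero_of_closure_span hQ'' hQ''ne
  obtain ⟨hρ'', μW'', hfin'', hinv'', Ψ'', hθ'', rfl⟩ := hv''S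
  have hmem'' : MemLp.toLp _ hθ'' ∈ Q''.toSubmodule := by
    rw [← SetLike.mem_coe, hQ'']
    exact subset_closure (Submodule.subset_span ⟨hρ'', μW'', hfin'', hinv'', Ψ'', hθ'', rfl⟩)
  haveI : IsFiniteMeasure μW' := hfin'
  haveI : IsFiniteMeasure μW'' := hfin''
  haveI : SMulInvariantMeasure ↥(UnitaryGroup.adelic (↥(maximalRealSubfield L)) L (IsCMField.complexConj L) 1 (JW (↥(maximalRealSubfield L)) L a'))
      (↥(UnitaryGroup.adelic (↥(maximalRealSubfield L)) L (IsCMField.complexConj L) 1 (JW (↥(maximalRealSubfield L)) L a')) ⧸ (UnitaryGroup.toAdelic (↥(maximalRealSubfield L)) L (IsCMField.complexConj L) 1 (JW (↥(maximalRealSubfield L)) L a')).range) μW' := hinv'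
  haveI : SMulInvariantMeasure ↥(UnitaryGroup.adelic (↥(maximalRealSubfield L)) L (IsCMField.complexConj L) 1 (JW (↥(maximalRealSubfield L)) L b))
      (↥(UnitaryGroup.adelic (↥(maximalRealSubfield L)) L (IsCMField.complexConj L) 1 (JW (↥(maximalRealSubfield L)) L b)) ⧸ (UnitaryGroup.toAdelic (↥(maximalRealSubfield L)) L (IsCMField.complexConj L) 1 (JW (↥(maximalRealSubfield L)) L b)).range) μW'' := hinv''
  have hmeets' : MeetsThetaLiftFromLine L 2 H e₁ dV hdV hdV0 P' lam hlam a' ιA :=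
    ⟨hρ', μW', hfin', hinv', charCM ξ', Ψ', hθ', hmem', hv'0⟩
  have hmeets'' : MeetsThetaLiftFromLine L 2 H e₁ dV hdV hdV0 P'' lam hlam b ιA :=
    ⟨hρ'', μW'', hfin'', hinv'', charCM ξ'', Ψ'', hθ'', hmem'', hv''0⟩
  -- 3. the central character `ψ` of `P` rides `≃ᵤ` (★ (T2)) and is trivial on the archimedean centre (hol test vector)
  obtain ⟨ψ, -, -, -, hψ⟩ := P.exists_centralCharacter_adelicCenter
  have hψ' := Summit.HodgeConjecture.HodgeConjecture.Cruxes.HLiu418.F0LD1UnitaryEquivTransport.centralCharacter_transport₂ L 2 H P P' hPQ' hψ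
  have hψ'' := Summit.HodgeConjecture.HodgeConjecture.Cruxes.HLiu418.F0LD1UnitaryEquivTransport.centralCharacter_transport₂ L 2 H P P'' hPQ'' hψ
  -- 4–5. the LINE half (part 1): equal finite classes and total positivity of `a′ b⁻¹`
  obtain ⟨hfin, hpos⟩ := Summit.HodgeConjecture.HodgeConjecture.Cruxes.HLiu418.F0LD1ThetaSpanLinePinOfBricks.spanLinePin_of_bricks hR hAwayU
    L ι H dV hdV hdV0 t ht g hg hsig hdef h4 𝔣 μ e₁ lam hlam hw a χ W σ hirr hsm j hj ιA hιA P hP hPσ a' b ξ' ξ'' Q' Q'' hQ' hQ'' hQ'ne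
    hPQ' hPQ''
  -- 6. transport `Q″`'s seam from `b` to `a′` (line transport brick), then organ (I): `Q̄(a′,ξ‴) ≤ Q″` and a seam
  have hmeets''a : MeetsThetaLiftFromLine L 2 H e₁ dV hdV hdV0 P'' lam hlam a' ιA :=
    hLT L ι H dV hdV hdV0 t ht g hg hsig hdef h4 μ e₁ lam hlam hw ιA hιA P'' b a' hmeets'' hfin hpos
  obtain ⟨ξ₃, hle₃, hseam₃⟩ :=
    Summit.HodgeConjecture.HodgeConjecture.Cruxes.HLiu418.F0LD1ThetaCharRigidOfDichotomy.thetaCharRigid₂_of_dichotomy hα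
      L ι H dV hdV hdV0 t ht g hg hsig hdef h4 μ e₁ lam hlam hw ιA hιA P'' a' hmeets''a
  obtain ⟨hρ₃, μW₃, hfin₃, hinv₃, Ψ₃, hθ₃, hmem₃, hne₃⟩ := hseam₃
  haveI : IsFiniteMeasure μW₃ := hfin₃
  haveI : SMulInvariantMeasure ↥(UnitaryGroup.adelic (↥(maximalRealSubfield L)) L (IsCMField.complexConj L) 1 (JW (↥(maximalRealSubfield L)) L a'))
      (↥(UnitaryGroup.adelic (↥(maximalRealSubfield L)) L (IsCMField.complexConj L) 1 (JW (↥(maximalRealSubfield L)) L a')) ⧸ (UnitaryGroup.toAdelic (↥(maximalRealSubfield L)) L (IsCMField.complexConj L) 1 (JW (↥(maximalRealSubfield L)) L a')).range) μW₃ := hinv₃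
  -- 7. the character pin on the line `a′`: `ξ′ = ξ‴` (same central character `ψ` on `Q′`, `Q″`)
  have hξ : ξ' = ξ₃ :=
    Summit.HodgeConjecture.HodgeConjecture.Cruxes.HLiu418.F0P6LD1ThetaCharacterPin.charCM_eq_of_seams_of_centralCharacter_eq
      L 2 H e₁ dV hdV hdV0 g lam hlam a' ιA hιA hιArat μ P' P'' hψ' hψ'' hρ' μW' Ψ' hρ₃ μW₃ Ψ₃ ξ' ξ₃ hθ' hθ₃ hmem' hv'0 hmem₃ hne₃
  subst hξ
  -- 8. `Q′ ≤ Q″` (every `(a′,ξ′)`-class lies in `Q″`, `Q″` is closed), and `Q′ ≠ ⊥`, `Q″` irreducible ⇒ `Q′ = Q″`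
  have hle : Q' ≤ Q'' := by
    intro v hv
    have hv' : v ∈ closure ((Submodule.span ℂ {v : (adelicGroupData (↥(maximalRealSubfield L)) L (IsCMField.complexConj L) 2 H).L2 μ | ∃ (hρ : HasThetaMajorants fun
          (p : ↥(UnitaryGroup.adelic (↥(maximalRealSubfield L)) L (IsCMField.complexConj L) 2 (Matrix.diagonal dV)) × ↥(UnitaryGroup.adelic (↥(maximalRealSubfield L)) L (IsCMField.complexConj L) 1 (JW (↥(maximalRealSubfield L)) L a'))) (Φ : piSchwartzBruhat (↥(maximalRealSubfield L)) (Fin n')) =>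
            pairRep (↥(maximalRealSubfield L)) L (IsCMField.complexConj L) 2 1 e₁ (Matrix.diagonal dV) (JW (↥(maximalRealSubfield L)) L a')
              (chiSplittingLine L e₁ dV hdV hdV0 (toHeckeCharacter L lam) (isUnitary_toHeckeCharacter L lam)
                ((isOscillatorChar_toHeckeCharacter_iff lam).mpr hlam) (TW (↥(maximalRealSubfield L)) a')
                (isUnit_det_TW (↥(maximalRealSubfield L)) a') (JW (↥(maximalRealSubfield L)) L a') (JW_eq (↥(maximalRealSubfield L)) L a'))
              p Φ)
            (μW : Measure (↥(UnitaryGroup.adelic (↥(maximalRealSubfield L)) L (IsCMField.complexConj L) 1 (JW (↥(maximalRealSubfield L)) L a')) ⧸ (UnitaryGroup.toAdelic (↥(maximalRealSubfield L)) L (IsCMField.complexConj L) 1 (JW (↥(maximalRealSubfield L)) L a')).range)) (_ : IsFiniteMeasure μW)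
            (_ : SMulInvariantMeasure ↥(UnitaryGroup.adelic (↥(maximalRealSubfield L)) L (IsCMField.complexConj L) 1 (JW (↥(maximalRealSubfield L)) L a')) (↥(UnitaryGroup.adelic (↥(maximalRealSubfield L)) L (IsCMField.complexConj L) 1 (JW (↥(maximalRealSubfield L)) L a')) ⧸ (UnitaryGroup.toAdelic (↥(maximalRealSubfield L)) L (IsCMField.complexConj L) 1 (JW (↥(maximalRealSubfield L)) L a')).range) μW)
            (Ψ : piSchwartzBruhat (↥(maximalRealSubfield L)) (Fin n'))
            (hθ : MemLp (toQuotFun (adelicGroupData (↥(maximalRealSubfield L)) L (IsCMField.complexConj L) 2 H) fun x =>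
              (lineThetaKernelDatum L 2 e₁ dV hdV hdV0 lam hlam a' hρ).thetaLiftFun μW Ψ (charCM ξ') (ιA x)) 2 μ),
            v = MemLp.toLp _ hθ} : Submodule ℂ ((adelicGroupData (↥(maximalRealSubfield L)) L (IsCMField.complexConj L) 2 H).L2 μ)) : Set ((adelicGroupData (↥(maximalRealSubfield L)) L (IsCMField.complexConj L) 2 H).L2 μ)) := by
      rw [← hQ']; exact hv
    have hsub : (Submodule.span ℂ {v : (adelicGroupData (↥(maximalRealSubfield L)) L (IsCMField.complexConj L) 2 H).L2 μ | ∃ (hρ : HasThetaMajorants fun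
          (p : ↥(UnitaryGroup.adelic (↥(maximalRealSubfield L)) L (IsCMField.complexConj L) 2 (Matrix.diagonal dV)) × ↥(UnitaryGroup.adelic (↥(maximalRealSubfield L)) L (IsCMField.complexConj L) 1 (JW (↥(maximalRealSubfield L)) L a'))) (Φ : piSchwartzBruhat (↥(maximalRealSubfield L)) (Fin n')) =>
            pairRep (↥(maximalRealSubfield L)) L (IsCMField.complexConj L) 2 1 e₁ (Matrix.diagonal dV) (JW (↥(maximalRealSubfield L)) L a')
              (chiSplittingLine L e₁ dV hdV hdV0 (toHeckeCharacter L lam) (isUnitary_toHeckeCharacter L lam)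
                ((isOscillatorChar_toHeckeCharacter_iff lam).mpr hlam) (TW (↥(maximalRealSubfield L)) a')
                (isUnit_det_TW (↥(maximalRealSubfield L)) a') (JW (↥(maximalRealSubfield L)) L a') (JW_eq (↥(maximalRealSubfield L)) L a'))
              p Φ)
            (μW : Measure (↥(UnitaryGroup.adelic (↥(maximalRealSubfield L)) L (IsCMField.complexConj L) 1 (JW (↥(maximalRealSubfield L)) L a')) ⧸ (UnitaryGroup.toAdelic (↥(maximalRealSubfield L)) L (IsCMField.complexConj L) 1 (JW (↥(maximalRealSubfield L)) L a')).range)) (_ : IsFiniteMeasure μW)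
            (_ : SMulInvariantMeasure ↥(UnitaryGroup.adelic (↥(maximalRealSubfield L)) L (IsCMField.complexConj L) 1 (JW (↥(maximalRealSubfield L)) L a')) (↥(UnitaryGroup.adelic (↥(maximalRealSubfield L)) L (IsCMField.complexConj L) 1 (JW (↥(maximalRealSubfield L)) L a')) ⧸ (UnitaryGroup.toAdelic (↥(maximalRealSubfield L)) L (IsCMField.complexConj L) 1 (JW (↥(maximalRealSubfield L)) L a')).range) μW)
            (Ψ : piSchwartzBruhat (↥(maximalRealSubfield L)) (Fin n'))
            (hθ : MemLp (toQuotFun (adelicGroupData (↥(maximalRealSubfield L)) L (IsCMField.complexConj L) 2 H) fun x =>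
              (lineThetaKernelDatum L 2 e₁ dV hdV hdV0 lam hlam a' hρ).thetaLiftFun μW Ψ (charCM ξ') (ιA x)) 2 μ),
            v = MemLp.toLp _ hθ} : Submodule ℂ ((adelicGroupData (↥(maximalRealSubfield L)) L (IsCMField.complexConj L) 2 H).L2 μ)) ≤ Q''.toSubmodule := by
      rw [Submodule.span_le]
      rintro _ ⟨hρ, μW, hfin, hinv, Ψ, hθ, rfl⟩
      exact hle₃ hρ μW hfin hinv Ψ hθ
    exact Q''.isClosed.closure_subset_iff.2 hsub hv'
  have hnt : Nontrivial Q'.toSubmodule := ⟨⟨⟨_, hmem'⟩, 0, fun h0 => hv'0 (congrArg Subtype.val h0)⟩⟩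
  exact ContRepresentation.ClosedSubrep.eq_of_le_of_isTopIrreducible hQ''irr hnt hle

set_option maxHeartbeats 3200000 in
/-- **THE PIN MODULO THE AWAY-FROM-`ι` SIGNS ONLY**: `thetaSpanPin₂_of_bricks` with its three ★ in-house inputs DISCHARGED — letter R₂ := ★
`lemD1_4SameLabelNonsplitCM₂_of_lineThetaTypesComplementary₁ (lineThetaTypesComplementary₁_of_zVan zVan_holds)` (LTC₁ ∕ (Z-van) road), organ (Gα) := ★
`thetaDichotomy₂_of_localBricks` of the six ★ bricks, line transport := ★ `lineTransport₂_of_kits`.  The one remaining input `hAwayU` is brick (β-away) in unitary-class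
currency (LD1-p02). [cite: Liu2021, App. B Thm. B.4 (2) (p. 98); proof of Cor. B.6 (3) (p. 99 L41–67); App. D proof of Prop. D.4 (1) (p. 131)] -/
theorem thetaSpanPin₂_of_away
    (hAwayU : ∀ (L : Type) [Field L] [NumberField L] [IsCMField L] (ι : L →+* ℂ) (H : Matrix (Fin 2) (Fin 2) L)
        (dV : Fin 2 → L) (hdV : ∀ i, IsCMField.complexConj L (dV i) = dV i) (hdV0 : ∀ i, dV i ≠ 0)
        (t : L) (ht : t ≠ 0) (g : GL (Fin 2) L)
        (hg : formCongr ((IsCMField.complexConj L : L ≃ₐ[↥(maximalRealSubfield L)] L) : L →+* L) g (t • H) = Matrix.diagonal dV),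
        (∃ T : GL (Fin 2) ℂ, formCongr (starRingEnd ℂ) T ((Matrix.diagonal dV).map ι) = Matrix.diagonal ![(1 : ℂ), -1]) →
        (∀ τ' : L →+* ℂ, InfinitePlace.mk τ' ≠ InfinitePlace.mk ι → ((Matrix.diagonal dV).map τ').PosDef) →
        4 ≤ Module.finrank ℚ L →
        ∀ (𝔣 : ConeFrame L H (cmPlace L ι))
          (μ : Measure (adelicGroupData (↥(maximalRealSubfield L)) L (IsCMField.complexConj L) 2 H).automorphicQuotient)
          [(adelicGroupData (↥(maximalRealSubfield L)) L (IsCMField.complexConj L) 2 H).IsAutomorphicMeasure μ]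
          {n' : ℕ} (e₁ : Fin 2 × Fin 1 ≃ Fin n')
          (lam : Literature.NumberTheory.Automorphic.IdeleClassGroup L →ₜ* Circle) (hlam : IsConjugateSymplectic L lam),
        ∀ (ιA : (adelicGroupData (↥(maximalRealSubfield L)) L (IsCMField.complexConj L) 2 H).Adelic →*
            ↥(UnitaryGroup.adelic (↥(maximalRealSubfield L)) L (IsCMField.complexConj L) 2 (Matrix.diagonal dV))),
          (∀ k, ((ιA k : ↥(UnitaryGroup.adelic (↥(maximalRealSubfield L)) L (IsCMField.complexConj L) 2 (Matrix.diagonal dV))) :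
                GL (Fin 2) (AdeleRing (𝓞 L) L)) =
              (toAdeleGL L g)⁻¹ * adelicVal (↥(maximalRealSubfield L)) L (IsCMField.complexConj L) 2 H k * toAdeleGL L g) →
        ∀ [CompactSpace (↥(UnitaryGroup.adelic (↥(maximalRealSubfield L)) L (IsCMField.complexConj L) 2 (Matrix.diagonal dV)) ⧸
            (UnitaryGroup.toAdelic (↥(maximalRealSubfield L)) L (IsCMField.complexConj L) 2 (Matrix.diagonal dV)).range)],
        ∀ (P P₁ : DiscreteAutomorphicRep (adelicGroupData (↥(maximalRealSubfield L)) L (IsCMField.complexConj L) 2 H) μ) (a₁ : (↥(maximalRealSubfield L))ˣ),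
          P.IsHolCotangentAt₂ (IsCMField.complexConj_ne_one L) (UnitaryGroup.complexConj_smul_infinitePlace L) (cmPlace L ι) 𝔣 →
          ContRepresentation.AreUnitarilyEquivalent P.space.toContRep P₁.space.toContRep →
          MeetsThetaLiftFromLine L 2 H e₁ dV hdV hdV0 P₁ lam hlam a₁ ιA →
          ∀ τ' : L →+* ℂ, InfinitePlace.mk τ' ≠ InfinitePlace.mk ι →
            (exponentAt hlam.infinityType τ' = -1 ∧ (τ' (algebraMap (↥(maximalRealSubfield L)) L a₁ * (2 * imagUnit L)⁻¹)).im < 0) ∨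
              (exponentAt hlam.infinityType τ' = 1 ∧ 0 < (τ' (algebraMap (↥(maximalRealSubfield L)) L a₁ * (2 * imagUnit L)⁻¹)).im)) :
    Summit.HodgeConjecture.HodgeConjecture.Cruxes.HLiu418.F0LD1ThetaSpanPinDefs.ThetaSpanPin₂ :=
  thetaSpanPin₂_of_bricks
    (Summit.HodgeConjecture.HodgeConjecture.Cruxes.HLiu418.F0LD2LetterR2OfLineComplementary.lemD1_4SameLabelNonsplitCM₂_of_lineThetaTypesComplementary₁
      (Summit.HodgeConjecture.HodgeConjecture.Cruxes.HLiu418.F0LD2SoftRoadJunction.lineThetaTypesComplementary₁_of_zVan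
        Summit.HodgeConjecture.HodgeConjecture.Cruxes.HLiu418.F0LD2SoftRoadJunction.zVan_holds))
    (Summit.HodgeConjecture.HodgeConjecture.Cruxes.HLiu418.F0LD1ThetaDichotomyOfBricks.thetaDichotomy₂_of_localBricks
      Summit.HodgeConjecture.HodgeConjecture.Cruxes.HLiu418.F0LD1ThetaSliceHermiteSum.hermiteSum_holds
      Summit.HodgeConjecture.HodgeConjecture.Cruxes.HLiu418.F0LD1ThetaSliceTorusProjector.torusProjector_holds
      Summit.HodgeConjecture.HodgeConjecture.Cruxes.HLiu418.F0LD1ThetaSliceFiniteLevel.finiteLevel_holds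
      Summit.HodgeConjecture.HodgeConjecture.Cruxes.HLiu418.F0LD1ThetaSliceMeasureScaling.measureScaling_holds
      Summit.HodgeConjecture.HodgeConjecture.Cruxes.HLiu418.F0LD1ThetaArchLadder.archLadder_holds
      Summit.HodgeConjecture.HodgeConjecture.Cruxes.HLiu418.F0LD1ThetaFinGeneration.finGeneration_holds)
    Summit.HodgeConjecture.HodgeConjecture.Cruxes.HLiu418.F0LD1LineTransportOfKits.lineTransport₂_of_kits
    hAwayU

/-! ## The pin, unconditionally -/

set_option maxHeartbeats 1600000 in
/-- **`thetaSpanPin₂_holds : ThetaSpanPin₂`** — the UNITARY-CLASS PIN OF THETA SPANS, every input discharged in-house: `thetaSpanPin₂_of_away` with `hAwayU :=` brick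
(β-away) ★ `F0LD1ArchTypeAwayOfInvariant.archTypeAway₂_of_invariant` (LD1-p02 (g6)) at the discrete `P₁ ≃ᵤ P`, its `K_c`-invariant non-zero vector supplied by the door ★
`F0LD1ThetaSpanDoorsOfEquiv.kcInvariant_of_areUnitarilyEquivalent` (LD2-p02 (g6)) from the hol₂ `P`.  This is the `hPin` input of the organ-(R) closer ★
`F0LD1ThetaRealisationOfOrthogonalCopy.thetaRealisation₂_of_orthogonalCopy` (leaf ED. 11 term `… stub_letter_A₂P_hodgeFree stub_letter_thetaIrr thetaSpanPin₂_holds`).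
[cite: Liu2021, App. B Thm. B.4 (2) (p. 98); proof of Cor. B.6 (3) (p. 99 L41–67); App. D Lem. D.1 (4), D.2 (1)(3); proof of Prop. D.4 (1) (p. 131)]
[cite: HarrisKudlaSweet1996, Thm. 6.1] [cite: DeitmarEchterhoff2014, Cor. 6.1.9] -/
theorem thetaSpanPin₂_holds : Summit.HodgeConjecture.HodgeConjecture.Cruxes.HLiu418.F0LD1ThetaSpanPinDefs.ThetaSpanPin₂ := by
  refine thetaSpanPin₂_of_away ?_
  intro L _ _ _ ι H dV hdV hdV0 t ht g hg hsig hdef h4 𝔣 μ _ n' e₁ lam hlam ιA hιA _ P P₁ a₁ hP he hmeets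
  exact Summit.HodgeConjecture.HodgeConjecture.Cruxes.HLiu418.F0LD1ArchTypeAwayOfInvariant.archTypeAway₂_of_invariant
    L ι H dV hdV hdV0 t ht g hg hsig hdef h4 μ e₁ ιA hιA P₁ lam hlam a₁ hmeets
    (Summit.HodgeConjecture.HodgeConjecture.Cruxes.HLiu418.F0LD1ThetaSpanDoorsOfEquiv.kcInvariant_of_areUnitarilyEquivalent
      L H (cmPlace L ι) 𝔣 P P₁ hP he)

end Summit.HodgeConjecture.HodgeConjecture.Cruxes.HLiu418.F0LD1ThetaSpanPinOfBricks

end
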